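import Literature.AnabelianGeometry.EtaleTheta.SettingModelChiInversionTheta
import Literature.AnabelianGeometry.EtaleTheta.ThetaCohomologyInversion
import HarnessLib

/-!
# The χ-twisted root model of [EtTh] §1: the twisted inversion IS an inversion automorphism in the sense of
# Prop. 1.5 (iii) — abc-iut-L2-t1's `ThetaSetting.IsInversionAut` INSTANTIATED at `modelχ` (proof-only)

Mochizuki, *The étale theta function …*, Publ. RIMS **45** (2009) [EtTh], Prop. 1.5 (iii) p. 23 ("any inversion automorphism
`ι` of `Π^tp_Ÿ`"), §1 p. 12 ("`Δ^ell_X := Δ^ab_X`"), §2 p. 36, Prop. 2.2 (i) p. 37 [cite: MochizukiEtTh2009, Prop 1.5 (iii) p.23].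
abc-iut cell, layer L2, prover abc-iut-L2-d1 (gen 5); PROOF-ONLY instance of abc-iut-L2-t1's predicate
`ThetaSetting.IsInversionAut D ι` (`ThetaCohomologyInversion`, census C11a: over `K`, `−1` on `Z`, `−1` on `(Δ^tp_X)^ell`,
preserves `Π^tp_{Y_N}`, `Π^tp_{Z_N}`) at `D := modelχ p`, `ι :=` abc-iut-L2-t1/abc-iut-w5-d249's twisted inversion
`twistedInversionTop (chi p)` (`(γ, σ) ↦ (ι_Γ γ, σ)`, `ι_Γ = σ̂ × (−1)`), from abc-iut-L2-t10's `modelχ` riders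
(`SettingModelChiCensusClauses`), abc-iut-L2-t1's level law `levelHom_gfpInv = negXY` / `gfpInv_mem_dY_iff` / `gfpInv_mem_dZ_iff`
(`SettingModel2InversionCoverings`) and this seat's `mem_ellKerχ_iff` (`SettingModelChiLevelKernels`).

* `twistedInversion_mem_YNχ_iff`, `twistedInversion_mem_ZNχ_iff` — `ι` preserves every `Π^tp_{Y_N}`, `Π^tp_{Z_N}`;
* **`twistedInversion_mul_self_mem_ellKer`** — `ι(g)·g ∈ Ker(Π^tp_X ↠ (Π^tp_X)^ell)` for `g ∈ Δ^tp_X`: the level shadow of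
  `ι_Γ γ · γ` is `negXY(h)·h = (0, 0, 2z − x·y)`, in the `z`-axis — **`ι` acts by `−1` on `(Δ^tp_X)^ell`** (`ell_apply`);
* **`isInversionAut_twistedInversion_modelχ : (modelχ p).IsInversionAut ι`**; hence BY NAME the L2-t1 consequences
  `IsInversionAut.thm16i` (agreeing with `thm16i_twistedInversion_modelχ`), `map_GtpY`, `map_GtpYddN`, `symm`.
NV: the hypothesis structure of the Prop. 1.5 (iii) inversion clause is INHABITED at a model with genuine cyclotomic action
(the clause's conclusion `InvClauses` for the model class is the sequel file).  SEMI-SYNTHETIC MODEL, consistency evidence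
only; nothing of [EtTh] asserted; no side taken on [IUTchIII] Cor. 3.12.
-/

noncomputable section

namespace Literature.AnabelianGeometry.EtaleTheta.SettingModel

open Literature.AnabelianGeometry.SemiGraphs _root_.Function

variable (p : ℕ) [Fact p.Prime]

/-- `negXY (x, y, z) = (−x, −y, z)`. [cite: MochizukiEtTh2009, Prop 2.2 (i) p.37] -/
private theorem negXY_apply_aux₂ {R : Type*} [CommRing R] (a : Heis R) : Heis.negXY a = ⟨-a.x, -a.y, a.z⟩ := rfl

/-! ### `ι` preserves the coverings `Y_N`, `Z_N` -/

/-- `ι(g) ∈ Π^tp_{Y_N} ↔ g ∈ Π^tp_{Y_N}` (all `N`). [cite: MochizukiEtTh2009, §1 p.13] -/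
theorem twistedInversion_mem_YNχ_iff (N : ℕ+) (g : PiTpχ p) :
    twistedInversion (chi p) g ∈ YNχ p N ↔ g ∈ YNχ p N := by
  rw [YNχ, GfpTwistData.mem_YN, GfpTwistData.mem_YN, twistedInversion_left, twistedInversion_right, gfpInv_mem_dY_iff]

/-- `ι(g) ∈ Π^tp_{Z_N} ↔ g ∈ Π^tp_{Z_N}` (all `N`). [cite: MochizukiEtTh2009, §1 p.14] -/
theorem twistedInversion_mem_ZNχ_iff (N : ℕ+) (g : PiTpχ p) :
    twistedInversion (chi p) g ∈ ZNχ p N ↔ g ∈ ZNχ p N := by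
  rw [ZNχ, GfpTwistData.mem_ZN, GfpTwistData.mem_ZN, twistedInversion_left, twistedInversion_right, gfpInv_mem_dZ_iff]

/-- `ι(Π^tp_{Y_N}) = Π^tp_{Y_N}` at the χ-model. [cite: MochizukiEtTh2009, §1 p.13] -/
theorem map_YNχ_twistedInversion (N : ℕ+) :
    (YNχ p N).map (twistedInversionTop (chi p) (isInducing_leftRightχ p)).toMulEquiv.toMonoidHom = YNχ p N := by
  ext g
  constructor
  · rintro ⟨h, hh, rfl⟩
    exact (twistedInversion_mem_YNχ_iff p N h).mpr hh
  · intro hg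
    exact ⟨twistedInversion (chi p) g, (twistedInversion_mem_YNχ_iff p N g).mpr hg,
      twistedInversion_twistedInversion (chi p) g⟩

/-- `ι(Π^tp_{Z_N}) = Π^tp_{Z_N}` at the χ-model. [cite: MochizukiEtTh2009, §1 p.14] -/
theorem map_ZNχ_twistedInversion (N : ℕ+) :
    (ZNχ p N).map (twistedInversionTop (chi p) (isInducing_leftRightχ p)).toMulEquiv.toMonoidHom = ZNχ p N := by
  ext g
  constructor
  · rintro ⟨h, hh, rfl⟩
    exact (twistedInversion_mem_ZNχ_iff p N h).mpr hh
  · intro hg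
    exact ⟨twistedInversion (chi p) g, (twistedInversion_mem_ZNχ_iff p N g).mpr hg,
      twistedInversion_twistedInversion (chi p) g⟩

/-! ### `ι` acts by `−1` on `(Δ^tp_X)^ell` -/

/-- **`ι(g)·g ∈ Ker(Π^tp_X ↠ (Π^tp_X)^ell)` for `g ∈ Δ^tp_X`**: the level shadow of `ι_Γ γ · γ` is
`negXY(h)·h = (0, 0, 2z − x·y)` — `x = y = 0` ("`Δ^ell_X := Δ^ab_X`", on which the inversion is `−1`).
[cite: MochizukiEtTh2009, §1 p.12] -/
theorem twistedInversion_mul_self_mem_ellKer {g : PiTpχ p} (hg : g ∈ (curveχ p).DeltaTemp) :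
    twistedInversion (chi p) g * g ∈ CurveTheta.ellKer (curveχ p) := by
  have hr : g.right = 1 := (mem_deltaTempχ_iff p g).mp hg
  rw [mem_ellKerχ_iff]
  refine ⟨fun N => ?_, by rw [SemidirectProduct.mul_right, twistedInversion_right, hr, mul_one]⟩
  rw [SemidirectProduct.mul_left, twistedInversion_left, twistedInversion_right, hr, map_one, MulAut.one_apply]
  change (levelHom N (gfpInv g.left * g.left)).x = 0 ∧ (levelHom N (gfpInv g.left * g.left)).y = 0
  rw [map_mul, levelHom_gfpInv, negXY_apply_aux₂]
  exact ⟨by simp, by simp⟩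

/-- **`ι` acts by `−1` on `(Δ^tp_X)^ell`**: `(ι g)^ell = (g^ell)⁻¹` for `g ∈ Δ^tp_X` (the `ell_apply` clause of
`IsInversionAut`). [cite: MochizukiEtTh2009, Prop 1.5 (iii) p.23] -/
theorem thetaToEll_toTheta_twistedInversion {g : PiTpχ p} (hg : g ∈ (curveχ p).DeltaTemp) :
    CurveTheta.thetaToEll (curveχ p) (CurveTheta.toTheta (curveχ p) (twistedInversion (chi p) g)) =
      (CurveTheta.thetaToEll (curveχ p) (CurveTheta.toTheta (curveχ p) g))⁻¹ := by
  rw [eq_inv_iff_mul_eq_one, ← map_mul, ← map_mul, ← MonoidHom.comp_apply, ← MonoidHom.mem_ker,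
    CurveTheta.ker_toEll]
  exact twistedInversion_mul_self_mem_ellKer p hg

/-! ### The instance -/

/-- **The twisted inversion of the χ-model IS an inversion automorphism** in the sense of abc-iut-L2-t1's
`ThetaSetting.IsInversionAut` (Prop. 1.5 (iii)): over `K`, `−1` on `Z`, `−1` on `(Δ^tp_X)^ell`, preserving every
`Π^tp_{Y_N}` and `Π^tp_{Z_N}`. [cite: MochizukiEtTh2009, Prop 1.5 (iii) p.23] -/
theorem isInversionAut_twistedInversion_modelχ :
    (ThetaSetting.modelχ p).IsInversionAut (twistedInversionTop (chi p) (isInducing_leftRightχ p)) where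
  aug_apply g := aug_twistedInversion_modelχ p g
  toZ_apply g := toZ_twistedInversion_modelχ p g
  ell_apply _ hg := thetaToEll_toTheta_twistedInversion p hg
  map_GtpYN N := map_YNχ_twistedInversion p N
  map_GtpZN N := map_ZNχ_twistedInversion p N

/-- `ι(Π^tp_Y) = Π^tp_Y` at the χ-model (abc-iut-L2-t1's consequence, BY NAME). [cite: MochizukiEtTh2009, §1 p.12] -/
theorem map_GtpY_twistedInversion_modelχ :
    (ThetaSetting.modelχ p).GtpY.map (twistedInversionTop (chi p) (isInducing_leftRightχ p)).toMulEquiv.toMonoidHom =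
      (ThetaSetting.modelχ p).GtpY :=
  (isInversionAut_twistedInversion_modelχ p).map_GtpY

/-- `ι(Π^tp_{Ÿ_N}) = Π^tp_{Ÿ_N}` at the χ-model (BY NAME). [cite: MochizukiEtTh2009, §1 p.17] -/
theorem map_GtpYddN_twistedInversion_modelχ (N : ℕ+) :
    ((ThetaSetting.modelχ p).GtpYddN N).map (twistedInversionTop (chi p) (isInducing_leftRightχ p)).toMulEquiv.toMonoidHom =
      (ThetaSetting.modelχ p).GtpYddN N :=
  (isInversionAut_twistedInversion_modelχ p).map_GtpYddN N

/-- The inverse automorphism is an inversion automorphism too (BY NAME). [cite: MochizukiEtTh2009, Prop 1.5 (iii) p.23] -/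
theorem isInversionAut_twistedInversion_modelχ_symm :
    (ThetaSetting.modelχ p).IsInversionAut (twistedInversionTop (chi p) (isInducing_leftRightχ p)).symm :=
  (isInversionAut_twistedInversion_modelχ p).symm

/-- **NV**: some `ThetaSetting` satisfying `IsEtThOrigin` admits an inversion automorphism in the sense of Prop. 1.5 (iii)
(the χ-model and its twisted inversion). [cite: MochizukiEtTh2009, Prop 1.5 (iii) p.23] -/
theorem _root_.Literature.AnabelianGeometry.EtaleTheta.ThetaSetting.exists_isEtThOrigin_and_isInversionAut :
    ∃ (D : ThetaSetting p) (ι : D.PiTemp ≃ₜ* D.PiTemp), D.IsEtThOrigin ∧ D.IsInversionAut ι :=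
  ⟨ThetaSetting.modelχ p, _, ThetaSetting.modelχ_isEtThOrigin p, isInversionAut_twistedInversion_modelχ p⟩

end Literature.AnabelianGeometry.EtaleTheta.SettingModel

end
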